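import Summits.AtomisticToContinuum.Crystallization.Theorems.ReggeStarCoercivityDefectFreeCrystallizesLayeredGluing01

/-!
# Part 2 of the proof of `stub_layeredGluing : LayeredGluing` (S5a, line `prestress-split-korn`, crux stmt-AtomisticToContinuum-13603); see the module docstring of the final part `ReggeStarCoercivityDefectFreeCrystallizesLayeredGluing.lean` for the overview
-/

noncomputable section

open scoped BigOperators Classical InnerProductSpace
open Filter Topology

namespace Summit.AtomisticToContinuum.Crystallization.Theorems.PrestressSplitKorn

open Summit.AtomisticToContinuum.Crystallization.Theses
open Summit.AtomisticToContinuum.Crystallization.Theses.ReggeStarCoercivity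
open Summit.AtomisticToContinuum.Crystallization.Theorems.DefectFreeCrystallizes.Negative.PredicateAPI
open Literature.MathematicalPhysics.StatisticalMechanics Literature.Geometry.DiscreteGeometry


/-- **Extraction of a limit template.** -/
theorem template_extraction (A : ℕ → (EuclideanSpace ℝ (Fin 3) →ₗᵢ[ℝ] (EuclideanSpace ℝ (Fin 3)))) (t : ℕ → EuclideanSpace ℝ (Fin 3)) (a : ℕ → ℝ) (s : ℕ → ℤ → ℤ)
    (z : ℕ → ℤ → ℝ) {C : ℝ}
    (h : ∀ᶠ k in atTop, InBox (a k) (z k) ∧ IsHaggSeq (s k) ∧ z k 0 = 0 ∧ ‖t k‖ ≤ C) :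
    ∃ (ψ : ℕ → ℕ) (A' : EuclideanSpace ℝ (Fin 3) →ₗᵢ[ℝ] (EuclideanSpace ℝ (Fin 3))) (t' : EuclideanSpace ℝ (Fin 3)) (a' : ℝ) (s' : ℤ → ℤ) (z' : ℤ → ℝ), StrictMono ψ ∧
      InBox a' z' ∧ IsHaggSeq s' ∧ z' 0 = 0 ∧
      (∀ v, Tendsto (fun k => A (ψ k) v) atTop (𝓝 (A' v))) ∧
      Tendsto (fun k => t (ψ k)) atTop (𝓝 t') ∧
      Tendsto (fun k => a (ψ k)) atTop (𝓝 a') ∧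
      (∀ m, ∀ᶠ k in atTop, s (ψ k) m = s' m) ∧
      (∀ m, Tendsto (fun k => z (ψ k) m) atTop (𝓝 (z' m))) := by
  set K : Set ((EuclideanSpace ℝ (Fin 3) →L[ℝ] (EuclideanSpace ℝ (Fin 3))) × (EuclideanSpace ℝ (Fin 3)) × ℝ × (ℤ → ℤ) × (ℤ → ℝ)) :=
    Metric.closedBall 0 1 ×ˢ Metric.closedBall 0 C ×ˢ Set.Icc (47 / 50 : ℝ) 1 ×ˢ
      Set.pi Set.univ (fun _ : ℤ => ({1, -1} : Set ℤ)) ×ˢ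
      Set.pi Set.univ (fun m : ℤ => Set.Icc (-|(m : ℝ)|) |(m : ℝ)|) with hK
  have hKc : IsCompact K :=
    (isCompact_closedBall _ _).prod ((isCompact_closedBall _ _).prod (isCompact_Icc.prod
      ((isCompact_univ_pi fun _ => (Set.toFinite _).isCompact).prod
        (isCompact_univ_pi fun _ => isCompact_Icc))))
  set D : ℕ → (EuclideanSpace ℝ (Fin 3) →L[ℝ] (EuclideanSpace ℝ (Fin 3))) × (EuclideanSpace ℝ (Fin 3)) × ℝ × (ℤ → ℤ) × (ℤ → ℝ) :=
    fun k => ((A k).toContinuousLinearMap, t k, a k, s k, z k) with hD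
  have hDK : ∃ᶠ k in atTop, D k ∈ K := by
    refine h.frequently.mono ?_
    rintro k ⟨hbox, hs, hz0, ht⟩
    simp only [hK, hD, Set.mem_prod, Metric.mem_closedBall, dist_zero_right, Set.mem_Icc, Set.mem_pi,
      Set.mem_univ, true_implies, Set.mem_insert_iff, Set.mem_singleton_iff]
    exact ⟨(A k).norm_toContinuousLinearMap_le, ht, ⟨hbox.1, hbox.2.1⟩, fun m => hs m,
      fun m => abs_le.1 (hbox.abs_z_le hz0 m).1⟩
  obtain ⟨⟨B, t', a', s', z'⟩, hmem, ψ, hψ, hlim⟩ := hKc.tendsto_subseq' hDK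
  have hB : Tendsto (fun k => (A (ψ k)).toContinuousLinearMap) atTop (𝓝 B) := hlim.fst_nhds
  have ht' : Tendsto (fun k => t (ψ k)) atTop (𝓝 t') := hlim.snd_nhds.fst_nhds
  have ha' : Tendsto (fun k => a (ψ k)) atTop (𝓝 a') := hlim.snd_nhds.snd_nhds.fst_nhds
  have hs' : Tendsto (fun k => s (ψ k)) atTop (𝓝 s') := hlim.snd_nhds.snd_nhds.snd_nhds.fst_nhds
  have hz' : Tendsto (fun k => z (ψ k)) atTop (𝓝 z') := hlim.snd_nhds.snd_nhds.snd_nhds.snd_nhds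
  have hev : ∀ v, Tendsto (fun k => A (ψ k) v) atTop (𝓝 (B v)) := fun v => by
    have := ((ContinuousLinearMap.apply ℝ (EuclideanSpace ℝ (Fin 3)) v).continuous.tendsto B).comp hB
    exact this.congr fun k => rfl
  have hnorm : ∀ v, ‖B v‖ = ‖v‖ := fun v =>
    tendsto_nhds_unique (hev v).norm (by simp)
  simp only [hK, Set.mem_prod, Metric.mem_closedBall, Set.mem_Icc, Set.mem_pi, Set.mem_univ,
    true_implies, Set.mem_insert_iff, Set.mem_singleton_iff] at hmem
  obtain ⟨-, -, ha'I, hs'I, -⟩ := hmem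
  have hzm : ∀ m, Tendsto (fun k => z (ψ k) m) atTop (𝓝 (z' m)) := fun m => tendsto_pi_nhds.1 hz' m
  have hsm : ∀ m, ∀ᶠ k in atTop, s (ψ k) m = s' m := fun m => by
    have := tendsto_pi_nhds.1 hs' m
    rwa [nhds_discrete, tendsto_pure] at this
  have hψev := hψ.tendsto_atTop.eventually h
  refine ⟨ψ, ⟨(B : EuclideanSpace ℝ (Fin 3) →ₗ[ℝ] (EuclideanSpace ℝ (Fin 3))), hnorm⟩, t', a', s', z', hψ, ⟨ha'I.1, ha'I.2, fun m => ?_⟩, hs'I, ?_,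
    hev, ht', ha', hsm, hzm⟩
  · have hinc : Tendsto (fun k => z (ψ k) (m + 1) - z (ψ k) m) atTop (𝓝 (z' (m + 1) - z' m)) :=
      (hzm (m + 1)).sub (hzm m)
    constructor
    · exact le_of_tendsto_of_tendsto (ha'.const_mul _) hinc
        (hψev.mono fun k hk => (hk.1.2.2 m).1)
    · exact le_of_tendsto_of_tendsto hinc (ha'.const_mul _)
        (hψev.mono fun k hk => (hk.1.2.2 m).2)
  · exact tendsto_nhds_unique (hzm 0)
      (tendsto_const_nhds.congr' (hψev.mono fun k hk => hk.2.2.1.symm))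

/-! ## Passage to the limit: the local limit is exactly layered -/

/-- **The limit set is exactly layered on every 2-ball.** -/
theorem exactNear_of_limit {δ : ℝ} (hδ : 0 < δ) {Z : ℕ → Set (EuclideanSpace ℝ (Fin 3))} {Y : Set (EuclideanSpace ℝ (Fin 3))}
    (hY : ∀ p ∈ Y, ∀ q ∈ Y, p ≠ q → δ ≤ dist p q)
    (hmatch : ∀ ρ γ : ℝ, 0 < γ → ∀ᶠ k in atTop, BallMatch γ ρ 0 (Z k) Y)
    {η r : ℕ → ℝ} (hη : Tendsto η atTop (𝓝 0)) (hr : Tendsto r atTop atTop)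
    (hloc : ∀ k, ∀ q ∈ Z k, ‖q‖ ≤ r k → SetLayeredNear (η k) (Z k) q)
    {p : EuclideanSpace ℝ (Fin 3)} (hp : p ∈ Y) : ExactNear Y p := by
  have hfin : ∀ w : EuclideanSpace ℝ (Fin 3), (Y ∩ Metric.closedBall w 1).Finite := fun w =>
    finite_of_forall_le_dist_of_subset_closedBall hδ (fun p hp q hq => hY p hp.1 q hq.1)
      Set.inter_subset_right
  -- (1) approximants of `p`
  obtain ⟨q, hqZ, hqp⟩ := exists_seq_tendsto hmatch hp
  -- (2) normalized template data at `q k`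
  have hgood : ∀ᶠ k in atTop, SetLayeredNear (η k) (Z k) (q k) := by
    have h1 : ∀ᶠ k in atTop, ‖q k‖ < ‖p‖ + 1 :=
      hqp.norm.eventually (gt_mem_nhds (by linarith [norm_nonneg p]))
    have h2 : ∀ᶠ k in atTop, ‖p‖ + 1 ≤ r k := hr.eventually_ge_atTop _
    filter_upwards [hqZ, h1, h2] with k hk hk1 hk2 using hloc k (q k) hk (by linarith)
  have hdata : ∀ k, ∃ (A : EuclideanSpace ℝ (Fin 3) →ₗᵢ[ℝ] (EuclideanSpace ℝ (Fin 3))) (t : EuclideanSpace ℝ (Fin 3)) (a : ℝ) (s : ℤ → ℤ) (z : ℤ → ℝ),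
      (q k ∈ Z k ∧ SetLayeredNear (η k) (Z k) (q k)) →
        InBox a z ∧ IsHaggSeq s ∧ z 0 = 0 ∧ ‖q k + t‖ ≤ η k ∧
        (∀ y ∈ Z k, dist y (q k) ≤ 2 → ∃ l, dist (y + t) (A (layeredPos a s z l)) ≤ η k) ∧
        (∀ l, dist (A (layeredPos a s z l)) (q k + t) ≤ 2 →
          ∃ y ∈ Z k, dist (y + t) (A (layeredPos a s z l)) ≤ η k) := by
    intro k
    by_cases hk : q k ∈ Z k ∧ SetLayeredNear (η k) (Z k) (q k)
    · obtain ⟨A, t, a, s, z, h⟩ := hk.2.normal_form hk.1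
      exact ⟨A, t, a, s, z, fun _ => h⟩
    · exact ⟨LinearIsometry.id, 0, 1, fun _ => 1, fun m => m, fun h => absurd h hk⟩
  choose A t a s z hAt using hdata
  have hev : ∀ᶠ k in atTop, InBox (a k) (z k) ∧ IsHaggSeq (s k) ∧ z k 0 = 0 ∧ ‖q k + t k‖ ≤ η k ∧
      (∀ y ∈ Z k, dist y (q k) ≤ 2 → ∃ l, dist (y + t k) (A k (layeredPos (a k) (s k) (z k) l)) ≤ η k) ∧
      (∀ l, dist (A k (layeredPos (a k) (s k) (z k) l)) (q k + t k) ≤ 2 →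
        ∃ y ∈ Z k, dist (y + t k) (A k (layeredPos (a k) (s k) (z k) l)) ≤ η k) := by
    filter_upwards [hqZ, hgood] with k h1 h2 using hAt k ⟨h1, h2⟩
  -- (3) bounds
  have hη1 : ∀ᶠ k in atTop, η k ≤ 1 := hη.eventually (ge_mem_nhds one_pos)
  have hqp1 : ∀ᶠ k in atTop, dist (q k) p ≤ 1 :=
    ((tendsto_iff_dist_tendsto_zero.1 hqp).eventually (ge_mem_nhds one_pos))
  have hbd : ∀ᶠ k in atTop, InBox (a k) (z k) ∧ IsHaggSeq (s k) ∧ z k 0 = 0 ∧ ‖t k‖ ≤ ‖p‖ + 2 := by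
    filter_upwards [hev, hη1, hqp1] with k hk h1 h2
    refine ⟨hk.1, hk.2.1, hk.2.2.1, ?_⟩
    have hq1 : ‖q k‖ ≤ ‖p‖ + 1 := by
      calc ‖q k‖ = ‖(q k - p) + p‖ := by rw [sub_add_cancel]
        _ ≤ ‖q k - p‖ + ‖p‖ := norm_add_le _ _
        _ ≤ 1 + ‖p‖ := by rw [← dist_eq_norm]; linarith
        _ = ‖p‖ + 1 := by ring
    calc ‖t k‖ = ‖(q k + t k) - q k‖ := by rw [add_sub_cancel_left]
      _ ≤ ‖q k + t k‖ + ‖q k‖ := norm_sub_le _ _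
      _ ≤ ‖p‖ + 2 := by linarith [hk.2.2.2.1]
  -- (4) extraction
  obtain ⟨ψ, A', t', a', s', z', hψ, hbox', hs', -, hA', ht', ha', hs'ev, hz'⟩ :=
    template_extraction A t a s z hbd
  have hψt : Tendsto ψ atTop atTop := hψ.tendsto_atTop
  have hevψ := hψt.eventually hev
  have hbdψ := hψt.eventually hbd
  have hqψ : Tendsto (fun k => q (ψ k)) atTop (𝓝 p) := hqp.comp hψt
  have hηψ : Tendsto (fun k => η (ψ k)) atTop (𝓝 0) := hη.comp hψt
  have hη1ψ : ∀ᶠ k in atTop, η (ψ k) ≤ 1 := hψt.eventually hη1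
  have hmatchψ : ∀ ρ γ : ℝ, 0 < γ → ∀ᶠ k in atTop, BallMatch γ ρ 0 (Z (ψ k)) Y :=
    fun ρ γ hγ => hψt.eventually (hmatch ρ γ hγ)
  have hTP : ∀ l, Tendsto (fun k => A (ψ k) (layeredPos (a (ψ k)) (s (ψ k)) (z (ψ k)) l)) atTop
      (𝓝 (A' (layeredPos a' s' z' l))) :=
    fun l => tendsto_isometry_apply hA' (tendsto_layeredPos ha' hs'ev hz' l)
  refine ⟨A', t', a', s', z', hbox', hs', ?_, ?_⟩
  · -- clause 1: points of `Y` in the open 2-ball are template points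
    intro y hy hyp
    obtain ⟨u, huZ, huy⟩ := exists_seq_tendsto hmatch hy
    have huψ : Tendsto (fun k => u (ψ k)) atTop (𝓝 y) := huy.comp hψt
    have huZψ : ∀ᶠ k in atTop, u (ψ k) ∈ Z (ψ k) := hψt.eventually huZ
    have h2 : ∀ᶠ k in atTop, dist (u (ψ k)) (q (ψ k)) ≤ 2 :=
      ((huψ.dist hqψ).eventually (Iio_mem_nhds hyp)).mono fun k hk => le_of_lt hk
    have hu1 : ∀ᶠ k in atTop, ‖u (ψ k)‖ < ‖y‖ + 1 :=
      huψ.norm.eventually (gt_mem_nhds (by linarith [norm_nonneg y]))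
    set C : ℝ := ‖y‖ + ‖p‖ + 4 with hC
    set B : ℤ := ⌈4 * C⌉ with hB
    set F : Finset (ℤ × ℤ × ℤ) := (Finset.Icc (-B) B) ×ˢ ((Finset.Icc (-B) B) ×ˢ (Finset.Icc (-B) B))
      with hF
    have hIcc : ∀ n : ℤ, |(n : ℝ)| ≤ 4 * C → n ∈ Finset.Icc (-B) B := fun n hn => by
      rw [Finset.mem_Icc]
      obtain ⟨h1, h2⟩ := abs_le.1 hn
      have hB' : 4 * C ≤ (B : ℝ) := Int.le_ceil _
      constructor
      · have : (-B : ℝ) ≤ n := by linarith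
        exact_mod_cast this
      · have : (n : ℝ) ≤ B := by linarith
        exact_mod_cast this
    have hFev : ∀ᶠ k in atTop, ∃ l ∈ F,
        dist (u (ψ k) + t (ψ k)) (A (ψ k) (layeredPos (a (ψ k)) (s (ψ k)) (z (ψ k)) l)) ≤ η (ψ k) := by
      filter_upwards [hevψ, huZψ, h2, hu1, hη1ψ, hbdψ] with k hk hu h2 hu1 hη1 hbd
      obtain ⟨l, hl⟩ := hk.2.2.2.2.1 _ hu h2
      refine ⟨l, ?_, hl⟩
      have hnorm : ‖layeredPos (a (ψ k)) (s (ψ k)) (z (ψ k)) l‖ ≤ C := by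
        rw [← (A (ψ k)).norm_map]
        calc ‖A (ψ k) (layeredPos (a (ψ k)) (s (ψ k)) (z (ψ k)) l)‖
            = ‖(u (ψ k) + t (ψ k)) -
                ((u (ψ k) + t (ψ k)) - A (ψ k) (layeredPos (a (ψ k)) (s (ψ k)) (z (ψ k)) l))‖ := by
              rw [sub_sub_cancel]
          _ ≤ ‖u (ψ k) + t (ψ k)‖ +
              dist (u (ψ k) + t (ψ k)) (A (ψ k) (layeredPos (a (ψ k)) (s (ψ k)) (z (ψ k)) l)) := by
              rw [dist_eq_norm]
              exact norm_sub_le _ _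
          _ ≤ (‖u (ψ k)‖ + ‖t (ψ k)‖) + η (ψ k) := add_le_add (norm_add_le _ _) hl
          _ ≤ C := by rw [hC]; linarith [hbd.2.2.2]
      obtain ⟨hm, hi, hj⟩ := label_bound hbd.1 hbd.2.1 hbd.2.2.1 l hnorm
      simp only [hF, Finset.mem_product]
      exact ⟨hIcc _ hm, hIcc _ hi, hIcc _ hj⟩
    obtain ⟨l, -, hl⟩ := exists_frequently_of_frequently_exists F hFev.frequently
    refine ⟨l, ?_⟩
    have hD := le_zero_of_frequently_le ((huψ.add ht').dist (hTP l)) hηψ hl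
    exact dist_le_zero.1 hD
  · -- clause 2: template points in the open 2-ball are points of `Y`
    intro l hl
    set w : EuclideanSpace ℝ (Fin 3) := A' (layeredPos a' s' z' l) with hw_def
    have hw := hTP l
    have h2 : ∀ᶠ k in atTop,
        dist (A (ψ k) (layeredPos (a (ψ k)) (s (ψ k)) (z (ψ k)) l)) (q (ψ k) + t (ψ k)) ≤ 2 :=
      ((hw.dist (hqψ.add ht')).eventually (Iio_mem_nhds hl)).mono fun k hk => hk.le
    have hC2 : ∀ᶠ k in atTop, ∃ y ∈ Z (ψ k),
        dist (y + t (ψ k)) (A (ψ k) (layeredPos (a (ψ k)) (s (ψ k)) (z (ψ k)) l)) ≤ η (ψ k) := by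
      filter_upwards [hevψ, h2] with k hk h2 using hk.2.2.2.2.2 l h2
    apply mem_of_forall_exists_dist_le (hfin _)
    intro γ hγ
    have hsmall : ∀ᶠ k in atTop, ∀ y',
        dist (y' + t (ψ k)) (A (ψ k) (layeredPos (a (ψ k)) (s (ψ k)) (z (ψ k)) l)) ≤ η (ψ k) →
          dist y' (w - t') < γ / 2 := by
      have hlim : Tendsto (fun k => η (ψ k) +
          dist (A (ψ k) (layeredPos (a (ψ k)) (s (ψ k)) (z (ψ k)) l) - t (ψ k)) (w - t')) atTop (𝓝 0) := by
        have := hηψ.add (tendsto_iff_dist_tendsto_zero.1 (hw.sub ht'))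
        rwa [add_zero] at this
      filter_upwards [hlim.eventually (gt_mem_nhds (half_pos hγ))] with k hk y' hy'
      calc dist y' (w - t')
          ≤ dist y' (A (ψ k) (layeredPos (a (ψ k)) (s (ψ k)) (z (ψ k)) l) - t (ψ k)) +
            dist (A (ψ k) (layeredPos (a (ψ k)) (s (ψ k)) (z (ψ k)) l) - t (ψ k)) (w - t') :=
            dist_triangle _ _ _
        _ = dist (y' + t (ψ k)) (A (ψ k) (layeredPos (a (ψ k)) (s (ψ k)) (z (ψ k)) l)) +
            dist (A (ψ k) (layeredPos (a (ψ k)) (s (ψ k)) (z (ψ k)) l) - t (ψ k)) (w - t') := by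
            congr 1
            rw [dist_eq_norm, dist_eq_norm]; congr 1; abel
        _ ≤ _ := add_le_add_left hy' _
        _ < γ / 2 := hk
    obtain ⟨k, ⟨y', hy'Z, hy'⟩, hsm, hm⟩ :=
      (hC2.and (hsmall.and (hmatchψ (‖w - t'‖ + γ) (γ / 2) (half_pos hγ)))).exists
    have hd := hsm y' hy'
    obtain ⟨y'', hy''Y, hd''⟩ := hm.2 y' hy'Z (by
      rw [dist_zero_right]
      calc ‖y'‖ = ‖(y' - (w - t')) + (w - t')‖ := by rw [sub_add_cancel]
        _ ≤ ‖y' - (w - t')‖ + ‖w - t'‖ := norm_add_le _ _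
        _ ≤ ‖w - t'‖ + γ := by rw [← dist_eq_norm]; linarith)
    refine ⟨y'', hy''Y, ?_⟩
    calc dist y'' (w - t') ≤ dist y' y'' + dist y' (w - t') := dist_triangle_left _ _ _
      _ ≤ γ / 2 + γ / 2 := add_le_add hd'' hd.le
      _ = γ := by ring

/-! ## The gluing lemma from exact rigidity -/

/-- **`ExactLayeredRigidity → LayeredGluing`** (compactness and contradiction). -/
theorem layeredGluing_of_exactRigidity (HEX : ExactLayeredRigidity) : LayeredGluing := by
  rw [layeredGluing_iff]
  intro δ hδ R ε hε
  by_contra H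
  have key : ∀ n : ℕ, ∃ (N : ℕ) (x : Fin N → EuclideanSpace ℝ (Fin 3)) (i : Fin N),
      (∀ i j : Fin N, i ≠ j → δ ≤ dist (x i) (x j)) ∧
      (∀ j : Fin N, dist (x j) (x i) ≤ n → Good x j ∧ LayeredNear (1 / ((n : ℝ) + 1)) x j) ∧
      ¬ ∃ (A : EuclideanSpace ℝ (Fin 3) →ₗᵢ[ℝ] (EuclideanSpace ℝ (Fin 3))) (t : EuclideanSpace ℝ (Fin 3)) (a : ℝ) (s : ℤ → ℤ) (z : ℤ → ℝ), InBox a z ∧ IsHaggSeq s ∧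
        GluingWindow R ε x A t a s z := by
    intro n
    by_contra hn
    push Not at hn
    refine H ⟨1 / ((n : ℝ) + 1), by positivity, n, fun N x hsep i hi => ?_⟩
    obtain ⟨A, t, a, s, z, h1, h2, h3⟩ := hn N x i hsep hi
    exact ⟨A, t, a, s, z, h1, h2, h3⟩
  choose N x i hsep hloc hbad using key
  -- recentred particle sets
  set Ys : ℕ → Set (EuclideanSpace ℝ (Fin 3)) := fun n => Set.range fun j => x n j - x n (i n) with hYs
  have hYsep : ∀ n, ∀ p ∈ Ys n, ∀ q ∈ Ys n, p ≠ q → δ ≤ dist p q := by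
    rintro n _ ⟨j, rfl⟩ _ ⟨j', rfl⟩ hne
    rw [dist_sub_right]
    exact hsep n j j' fun h => hne (by rw [h])
  obtain ⟨φ, Y, hφ, hYsep', hmatch⟩ := exists_subseq_forall_eventually_ballMatch hδ Ys hYsep
  have hφt : Tendsto φ atTop atTop := hφ.tendsto_atTop
  have hfin : ∀ w : EuclideanSpace ℝ (Fin 3), (Y ∩ Metric.closedBall w 1).Finite := fun w =>
    finite_of_forall_le_dist_of_subset_closedBall hδ (fun p hp q hq => hYsep' p hp.1 q hq.1)
      Set.inter_subset_right
  -- `0 ∈ Y`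
  have h0 : (0 : EuclideanSpace ℝ (Fin 3)) ∈ Y := by
    apply mem_of_forall_exists_dist_le (hfin 0)
    intro γ hγ
    obtain ⟨k, hk⟩ := (hmatch 1 γ hγ).exists
    obtain ⟨y, hy, hd⟩ := hk.2 0 ⟨i (φ k), by simp⟩ (by simp)
    exact ⟨y, hy, by rwa [dist_comm]⟩
  -- every point of `Y` is exactly layered
  have hloc' : ∀ k, ∀ q ∈ Ys (φ k), ‖q‖ ≤ (φ k : ℝ) →
      SetLayeredNear (1 / ((φ k : ℝ) + 1)) (Ys (φ k)) q := by
    rintro k _ ⟨j, rfl⟩ hj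
    have := (hloc (φ k) j (by rwa [dist_eq_norm])).2
    exact setLayeredNear_of_layeredNear this
  have hexact : ∀ p ∈ Y, ExactNear Y p := fun p hp =>
    exactNear_of_limit hδ hYsep' (fun ρ γ hγ => hmatch ρ γ hγ)
      (tendsto_one_div_add_atTop_nhds_zero_nat.comp hφt)
      (tendsto_natCast_atTop_atTop.comp hφt) hloc' hp
  -- the global template and the contradiction
  obtain ⟨A, t, a, s, z, hbox, hs, hYeq⟩ := HEX Y ⟨0, h0⟩ ⟨δ, hδ, hYsep'⟩ hexact
  obtain ⟨k, hk⟩ := (hmatch (R + ‖t‖) (ε / 2) (half_pos hε)).exists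
  refine hbad (φ k) ⟨A, t - x (φ k) (i (φ k)), a, s, z, hbox, hs, ?_, ?_⟩
  · intro l hl
    have hy : A (layeredPos a s z l) - t ∈ Y := by rw [hYeq]; exact ⟨l, by rw [sub_add_cancel]⟩
    obtain ⟨q, ⟨j, rfl⟩, hq⟩ := hk.1 _ hy (by
      rw [dist_zero_right]
      exact (norm_sub_le _ _).trans (by linarith))
    refine ⟨j, ?_⟩
    calc dist (x (φ k) j + (t - x (φ k) (i (φ k)))) (A (layeredPos a s z l))
        = dist (x (φ k) j - x (φ k) (i (φ k))) (A (layeredPos a s z l) - t) := by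
          rw [dist_eq_norm, dist_eq_norm]; congr 1; abel
      _ ≤ ε / 2 := hq
      _ ≤ ε := by linarith
  · intro j hj
    obtain ⟨y, hy, hd⟩ := hk.2 _ ⟨j, rfl⟩ (by
      rw [dist_zero_right]
      calc ‖x (φ k) j - x (φ k) (i (φ k))‖ = ‖(x (φ k) j + (t - x (φ k) (i (φ k)))) - t‖ := by
            congr 1; abel
        _ ≤ ‖x (φ k) j + (t - x (φ k) (i (φ k)))‖ + ‖t‖ := norm_sub_le _ _
        _ ≤ R + ‖t‖ := by linarith)
    rw [hYeq] at hy
    obtain ⟨l, hl⟩ := hy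
    refine ⟨l, ?_⟩
    calc dist (x (φ k) j + (t - x (φ k) (i (φ k)))) (A (layeredPos a s z l))
        = dist (x (φ k) j - x (φ k) (i (φ k))) y := by
          rw [← hl, dist_eq_norm, dist_eq_norm]; congr 1; abel
      _ ≤ ε / 2 := hd
      _ ≤ ε := by linarith

/-! ## Part II — from identity-framed local templates to ONE global template -/

section Framed

variable {a : ℝ} {s : ℤ → ℤ} {z : ℤ → ℝ}

/-! ### Template facts -/

/-- Auxiliary step `norm_sq_fin3` of the proof of `stub_layeredGluing` (S5a); see the final part's module docstring. -/
theorem norm_sq_fin3 (x : EuclideanSpace ℝ (Fin 3)) : ‖x‖ ^ 2 = x 0 ^ 2 + x 1 ^ 2 + x 2 ^ 2 := by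
  rw [EuclideanSpace.norm_sq_eq, Fin.sum_univ_three, Real.norm_eq_abs, Real.norm_eq_abs,
    Real.norm_eq_abs, sq_abs, sq_abs, sq_abs]

/-- Auxiliary step `haggLabel_neg_one` of the proof of `stub_layeredGluing` (S5a); see the final part's module docstring. -/
theorem haggLabel_neg_one (s : ℤ → ℤ) : haggLabel s (-1) = -s (-1) := by
  have := haggLabel_succ s (-1)
  simp only [neg_add_cancel, haggLabel_zero] at this
  linarith

/-- Layer `0` of the template: `i u + j v`. -/
theorem layeredPos_layer_zero (hz0 : z 0 = 0) (i j : ℤ) :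
    layeredPos a s z (0, i, j) = (i : ℝ) • triangularVec₁ a + (j : ℝ) • triangularVec₂ a := by
  simp [layeredPos, hz0]

/-- The first site of layer `1`: `s 0 • w + z 1 • e₃`. -/
theorem layeredPos_one : layeredPos a s z (1, 0, 0) = (s 0 : ℝ) • barlowOffset a + z 1 • layerNormal 1 := by
  have : haggLabel s 1 = s 0 := by
    have := haggLabel_succ s 0; simp only [zero_add, haggLabel_zero] at this; exact this
  simp [layeredPos, this]

/-- The first site of layer `-1`: `-(s (-1)) • w + z (-1) • e₃`. -/
theorem layeredPos_neg_one :
    layeredPos a s z (-1, 0, 0) = (-(s (-1)) : ℝ) • barlowOffset a + z (-1) • layerNormal 1 := by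
  simp [layeredPos, haggLabel_neg_one]

/-- Auxiliary step `norm_sq_planar` of the proof of `stub_layeredGluing` (S5a); see the final part's module docstring. -/
theorem norm_sq_planar (a : ℝ) (i j : ℝ) :
    ‖i • triangularVec₁ a + j • triangularVec₂ a‖ ^ 2 = a ^ 2 * (i ^ 2 + i * j + j ^ 2) := by
  have h3 : (√3 : ℝ) ^ 2 = 3 := Real.sq_sqrt (by norm_num)
  rw [norm_sq_fin3]
  simp [triangularVec₁, triangularVec₂]
  linear_combination (a ^ 2 * j ^ 2 / 4) * h3

/-- Auxiliary step `norm_sq_offset` of the proof of `stub_layeredGluing` (S5a); see the final part's module docstring. -/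
theorem norm_sq_offset (a σ h : ℝ) (hσ : σ = 1 ∨ σ = -1) :
    ‖σ • barlowOffset a + h • layerNormal 1‖ ^ 2 = a ^ 2 / 3 + h ^ 2 := by
  have h3 : (√3 : ℝ) ^ 2 = 3 := Real.sq_sqrt (by norm_num)
  have hσ2 : σ ^ 2 = 1 := by rcases hσ with rfl | rfl <;> norm_num
  rw [norm_sq_fin3]
  simp [barlowOffset, layerNormal]
  linear_combination (a ^ 2 * σ ^ 2 / 36) * h3 + (a ^ 2 / 3) * hσ2

/-- Auxiliary step `norm_lt_two_of_sq` of the proof of `stub_layeredGluing` (S5a); see the final part's module docstring. -/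
theorem norm_lt_two_of_sq {x : EuclideanSpace ℝ (Fin 3)} (h : ‖x‖ ^ 2 < 4) : ‖x‖ < 2 := by
  nlinarith [norm_nonneg x]

/-- Auxiliary step `InBox.norm_u_lt` of the proof of `stub_layeredGluing` (S5a); see the final part's module docstring. -/
theorem InBox.norm_u_lt (h : InBox a z) : ‖triangularVec₁ a‖ < 2 := by
  apply norm_lt_two_of_sq
  have := norm_sq_planar a 1 0
  simp only [one_smul, zero_smul, add_zero] at this
  rw [this]; nlinarith [h.1, h.2.1]

/-- Landing anchor of this file (registered stub of crux stmt-AtomisticToContinuum-13603; re-exports a result above). -/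
theorem layeredGluing_part02_anchor :
    ExactLayeredRigidity → LayeredGluing :=
  layeredGluing_of_exactRigidity

end Framed

end Summit.AtomisticToContinuum.Crystallization.Theorems.PrestressSplitKorn
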